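import Summits.Langlands.Langlands.Theses.QuarterDeficit1951
import Literature.NumberTheory.GaloisRepresentations.GaloisRepUnramifiedProofs
import Literature.NumberTheory.GaloisRepresentations.TateUnramifiedLiftingHolds
import Literature.NumberTheory.GaloisRepresentations.DirichletCharacterOfGaloisCharacter
import Literature.FieldTheory.AlgClosed.PadicAlgClEquivComplex
import Literature.NumberTheory.Automorphic.BCDTTheoremBWildAtThreeDet
import Summits.Langlands.Langlands.Theorems.QuarterDeficit1951IcosahedralSupplyArtinSupply

/-!
# Route `QuarterDeficit1951` (Langlands) — crux `IcosahedralSupply` (stmt-Langlands-15899), line `Sketch`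

**The crux restated off `ℓ = 1951`, proved**: `IcosahedralSupply_away` — for every reciprocity
datum `RD` and every prime `ℓ ≥ 17` with `ℓ ≠ 1951` there are `ι : ℚ̄_ℓ ≃+* ℂ` and an `ℓ`-adic framed
representation `ρ : Γ_ℚ → GL₂(ℚ̄_ℓ)` which is geometric in the summit's sense (unramified almost
everywhere and de Rham at `v ∣ ℓ` for `RD.pst` — automatic, `ρ` being unramified at `ℓ ≠ 1951`),
irreducible, of finite image, even, of Artin conductor `1951`, with the order-`5` determinant and
the icosahedral Frobenius fingerprint away from `1951`.  This is the statement of the crux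
`IcosahedralSupply` with the single extra hypothesis `ℓ ≠ 1951`; the `ℓ = 1951` instance of the crux
as typed asks in addition that the `ε`-pinned datum `RD.pst 1951 (1951)` make a RAMIFIED finite-image
representation de Rham, which is independent of the tree
(`Cruxes/IcosahedralSupply/NegativeEpsilonIndependence1951.md`, `Cruxes/IcosahedralSupply/Disproof.lean` §D).
-/

set_option linter.dupNamespace false

noncomputable section

open scoped NumberField MatrixGroups
open Field IsDedekindDomain Polynomial
open Literature.NumberTheory.GaloisRepresentations Literature.NumberTheory.PAdicHodge

namespace Summit.Langlands.Langlands.Theorems.QuarterDeficit1951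

/-- The geometric conjunct off `ℓ = 1951` needs no `p`-adic Hodge theory: for EVERY datum an
unramified local representation is de Rham (structure field), and a representation unramified at
every `v` of residue characteristic `≠ 1951` is unramified at every `v ∣ ℓ` when `ℓ ≠ 1951`
(crux-ideate Sketch, `isGeometricFramed_of_unramified_away`). [cite: FontaineAsterisque223III, §5] -/
theorem isGeometricFramed_of_unramified_away {ℓ : ℕ} [Fact ℓ.Prime] {n : ℕ} (hℓ : ℓ ≠ 1951)
    (RD : Summit.Langlands.ReciprocityData ℚ) (ρ : FramedGaloisRep ℚ (PadicAlgCl ℓ) n)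
    (hunr : ∀ v : HeightOneSpectrum (𝓞 ℚ), v.residueCard ≠ 1951 → ρ.IsUnramifiedAt v)
    (hcof : ∀ᶠ v : HeightOneSpectrum (𝓞 ℚ) in Filter.cofinite, ρ.IsUnramifiedAt v) :
    Summit.Langlands.IsGeometricFramed RD ρ := by
  refine ⟨hcof, fun v hv => ?_⟩
  apply PstWeilDeligneData.isDeRhamFramed_of_isLocallyUnramified
  have h : ρ.IsUnramifiedAt v := hunr v (by
    rw [Rat.residueCard_eq_of_natCast_mem Fact.out hv]; exact hℓ)
  intro σ hσ
  have h1 := (GaloisRep.isUnramifiedAt_iff_toLocal_holds v ρ.toGaloisRep).1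
    ((FramedGaloisRep.isUnramifiedAt_toGaloisRep_iff v ρ).2 h) σ hσ
  have h2 : Matrix.toLin' (((ρ.toLocal v) σ : GL (Fin n) (PadicAlgCl ℓ)) :
      Matrix (Fin n) (Fin n) (PadicAlgCl ℓ)) = Matrix.toLin' 1 := by
    rw [Matrix.toLin'_one]
    refine LinearMap.ext fun w => ?_
    simpa using congr($h1 w)
  exact Units.ext (Matrix.toLin'.injective h2)

/-- Only the place `(1951)` has residue characteristic `1951`, so "unramified at every `v` of
residue characteristic `≠ 1951`" is unramified almost everywhere. [folklore] -/
theorem eventually_isUnramifiedAt_of_away {A : Type*} [CommRing A] [TopologicalSpace A] {n : ℕ}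
    {ρ : FramedGaloisRep ℚ A n}
    (hunr : ∀ v : HeightOneSpectrum (𝓞 ℚ), v.residueCard ≠ 1951 → ρ.IsUnramifiedAt v) :
    ∀ᶠ v : HeightOneSpectrum (𝓞 ℚ) in Filter.cofinite, ρ.IsUnramifiedAt v := by
  have hp : Nat.Prime 1951 := by norm_num
  have hfin1 : ({v : HeightOneSpectrum (𝓞 ℚ) | v.residueCard = 1951} : Set _).Finite := by
    refine (Set.finite_singleton
      ((Rat.HeightOneSpectrum.primesEquiv (R := 𝓞 ℚ)).symm ⟨1951, hp⟩)).subset ?_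
    intro v hv
    rw [Set.mem_singleton_iff, Equiv.eq_symm_apply]
    exact Subtype.ext ((FramedRep.residueCard_eq_coe_primesEquiv' v).symm.trans hv)
  exact Filter.eventually_of_mem hfin1.compl_mem_cofinite fun v hv => hunr v hv

/-- **The crux restated off `ℓ = 1951`** (what `closes` uses, at `ℓ = 17`): for every reciprocity
datum and every prime `ℓ ≥ 17`, `ℓ ≠ 1951`, the even icosahedral supply of conductor `1951` exists
`ℓ`-adically, geometric in the summit's sense. [cite: DoudMoore2006, §2 and §4] -/
theorem IcosahedralSupply_away (RD : Summit.Langlands.ReciprocityData ℚ) (ℓ : ℕ) [Fact ℓ.Prime]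
    (_h17 : 17 ≤ ℓ) (hℓ : ℓ ≠ 1951) :
    ∃ (ι : PadicAlgCl ℓ ≃+* ℂ) (ρ : FramedGaloisRep ℚ (PadicAlgCl ℓ) 2),
      Summit.Langlands.IsGeometricFramed RD ρ ∧ (ρ.toGaloisRep.IsIrreducible ∧
      (Set.range ρ).Finite ∧ ρ.IsEven ∧ ρ.toGaloisRep.artinConductorNat = 1951 ∧
      ∃ χ₀ : DirichletCharacter ℂ 1951, orderOf χ₀ = 5 ∧
        ∀ v : HeightOneSpectrum (𝓞 ℚ), v.residueCard ≠ 1951 →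
          ρ.IsUnramifiedAt v ∧ ∃ t d : PadicAlgCl ℓ,
            ρ.HasFrobCharpolyAt v (X ^ 2 - C t * X + C d) ∧
            ι d = (χ₀ (v.residueCard : ZMod 1951))⁻¹ ∧
            (t ^ 2 = 0 ∨ t ^ 2 = d ∨ t ^ 2 = 4 * d ∨ t ^ 4 - 3 * d * t ^ 2 + d ^ 2 = 0)) := by
  obtain ⟨ι⟩ := PadicAlgCl.nonempty_ringEquiv_complex ℓ
  obtain ⟨ρ, hirr, hfin, heven, hcond, χ₀, hχ₀, hv⟩ :=
    artinSupply (PadicAlgCl ℓ) (ι : PadicAlgCl ℓ →+* ℂ)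
  have hunr : ∀ v : HeightOneSpectrum (𝓞 ℚ), v.residueCard ≠ 1951 → ρ.IsUnramifiedAt v :=
    fun v hv' => (hv v hv').1
  exact ⟨ι, ρ, isGeometricFramed_of_unramified_away hℓ RD ρ hunr
    (eventually_isUnramifiedAt_of_away hunr), hirr, hfin, heven, hcond, χ₀, hχ₀, hv⟩

end Summit.Langlands.Langlands.Theorems.QuarterDeficit1951

end
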